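import Literature.AnabelianGeometry.EtaleTheta.Discharge.Sec5Thm57FinalKnitV6OfThetaSettingOfEtale
import Literature.AnabelianGeometry.EtaleTheta.LogDivisorModelTateTowerArithmeticProp32iiiMLF

/-!
# [EtTh] §5, Theorem 5.7 — FINAL KNIT v6 with the (C) clause «⋂_N (K^×)^N = 1» (Prop. 3.2 (iii)) DISCHARGED at an MLF constant field `K'`
# (ANY finite extension of `ℚ_p`): the root-side knit (p476561) and the Setting knit of record (p480505) (pp. 296, 322, 329–331 / PDF pp. 70, 96, 103–105)

Mochizuki, *The étale theta function and its Frobenioid-theoretic manifestations*, Publ. RIMS **45** (2009)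
[cite: MochizukiEtTh2009, Thm 5.7 p.329–330 (PDF pp.103–104); Prop 3.2 (iii) p.296 (PDF p.70); §5 p.322 (PDF p.96) «K a finite extension of
ℚ_p»; Lem 5.8 p.331 (PDF p.105); Thm 5.6 p.328 (PDF p.102); Cor 2.19 (iii) p.291 (PDF p.65)].  abc-iut cell, layer L2, node `EtTh:Thm5.7`;
abc-iut-L2-lead (gen 6) R872 «THM57-V6-HK-MLF KNIT» (seat abc-iut-f-123 gen 7).  PROOF-ONLY (0 definitions, 0 instances, 0 notation, 0 new
named facts; nothing landed is edited or restated).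

THE POINT.  In the v6 knits the (C) column carries the binder `hK : ∀ x : T.Kˣ, (∀ N ≥ 1, ∃ d, d ^ N = x) → x = 1` — [EtTh] Prop. 3.2 (iii)
for the tower's constant field `K'`.  Print's constant field is a finite extension of `ℚ_p` (§5 p.322), and for EVERY such field the clause is
a theorem of the tree: `MLFDivisible.units_eq_one_of_forall_exists_pow_eq` (p480502; `𝓞_{K'}` Dedekind with finite residue rings, Krull
intersection).  THIS FILE re-states the two knits of record with `hK` REPLACED by the instance-implicit binders `[Algebra ℚ_[p] K']
[FiniteDimensional ℚ_[p] K']` on the explicit constant field `K'` of the family constructors (`T.K` IS `K'` along `hT`; never declared):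
* `thetaRootPreservedAll_ofConnectedTemperoidYddFamily_final_v6_of_mlf` ⟸ abc-iut-f-123's `…_final_v6` (p476561) — the generic root side at
  any `(X, 𝒯, ιX)`, any prime `p` with `K'/ℚ_p` finite; displayed (C) = `htorsfam` only;
* `thetaRootPreservedAll_ofThetaSettingYddFamily_final_v6_of_cor219iiiStd_of_mlf` ⟸ abc-iut-w6-d049's (e3) `…_final_v6_of_cor219iiiStd`
  (p480505) — the tower OF THE SETTING, (C) from the étale side, `p` = the residue characteristic of `DS : ThetaSetting p`; the (C) display
  at an MLF constant field then has NO `hK` line: {dictionary at every `M ∈ Es`, compatible pins `η`, `(γ, γ_μ)` + `hstd` (F-0652 SHAPE),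
  glue, `hinfη`, `hsep`, `hK4fam` (Thm. 5.6 at each member)}.
Every other binder is VERBATIM its source (their module docstrings give the census).  HONEST FRAMING: kernel-checked one-binder substitutions
into landed theorems for data so parametrised (no `TemperedFrobenioid` of an actual curve is constructed in the tree); F-0620 / `Prop15iii` / the
F-0652 SHAPE stay FACT-policy labels or named residuals; nothing of [EtTh] beyond Prop. 3.2 (iii) is asserted unconditionally; typed ≠ discharged —
PROVED modulo the displayed binders; no side taken on anything downstream ([IUTchIII] Cor. 3.12 in particular).
-/

noncomputable section

namespace Literature.AnabelianGeometry.EtaleTheta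

open CategoryTheory Opposite Literature.AlgebraicGeometry.Frobenioids Literature.AnabelianGeometry.SemiGraphs
  Literature.AnabelianGeometry.SemiGraphs.GaloisObjects

universe v₀ u₁ v₁

namespace ThetaFrobenioidTower

section DictionaryV6MLF

variable {K : Type} [Field K] {X : SemiGraphs.TemperedArithmeticGroup.{0} K} {D₀ : Type} [Category.{v₀} D₀]
  {V : FrdIMonoidStub.{0}} {T₀ : RealifiedDivisorMonoids (D₀ := D₀) V}
  {VD : FrdICatStub.{1, 0, 0} (ConnectedPart (BTemp X.Pi))}
  {tf : TemperedFrobenioid T₀ (ConnectedPart (BTemp X.Pi)) VD} {hZ : tf.monoidType = MonoidType.Z}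
  {hP : ∀ A : (ConnectedPart (BTemp X.Pi))ᵒᵖ, IsPerfect (tf.Φ.carrier A)}
  {NH : Subgroup (Field.absoluteGaloisGroup K) → tf.category → ℕ+ → Prop}
  {E : Set ℕ+} (𝒯 : ThetaEnvTower.{0} E) (ιX : 𝒯.PiX ≃ₜ* X.Pi)
  {pullFrac : ∀ {A A' : (BiKummerSetting.mkOfConnectedTemperoidYddTower X tf hZ hP NH 𝒯 ιX).C} (_ : A' ⟶ A),
    (BiKummerSetting.mkOfConnectedTemperoidYddTower X tf hZ hP NH 𝒯 ιX).biratUnits A →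
      (BiKummerSetting.mkOfConnectedTemperoidYddTower X tf hZ hP NH 𝒯 ιX).biratUnits A'}
  {lv : ℕ+}
  {θ : (BiKummerSetting.mkOfConnectedTemperoidYddTower X tf hZ hP NH 𝒯 ιX).biratUnits
    (BiKummerSetting.mkOfConnectedTemperoidYddTower X tf hZ hP NH 𝒯 ιX).Aodot}
  {Bl : (BiKummerSetting.mkOfConnectedTemperoidYddTower X tf hZ hP NH 𝒯 ιX).C}
  {Pl : (BiKummerSetting.mkOfConnectedTemperoidYddTower X tf hZ hP NH 𝒯 ιX).FractionPair θ Bl}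
  {Rl : (BiKummerSetting.mkOfConnectedTemperoidYddTower X tf hZ hP NH 𝒯 ιX).NthRoot θ Pl lv pullFrac}
  (h : ModelFrobenioid.Hypotheses tf.divisorMonoid tf.ratFnFunctor)
  (Q : FrobenioidTheta.ThetaSubquotientStub.{0} (ConnectedPart (BTemp X.Pi))) (odd_l : Odd (lv : ℕ))
  (R : ∀ N : ℕ+, (BiKummerSetting.mkOfConnectedTemperoidYddTower X tf hZ hP NH 𝒯 ιX).NthRoot Rl.root Rl.pair N pullFrac)
  (K' : Type) [Field K'] {X₀ : ConnectedPart (BTemp X.Pi)}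
  (hX₀ : ∀ Y : ConnectedPart (BTemp X.Pi), Subsingleton (Y ⟶ X₀)) (t : ∀ N : ℕ+, (R N).BN.base ⟶ X₀)
  (c₀ : K'ˣ →* (tf.ratFnFunctor.obj (op X₀))ˣ)
  (hc₀ : Function.Injective c₀) (ht : ∀ N : ℕ+, Function.Injective (tf.ratFnFunctor.map (t N).op).hom)
  (hinvc : ∀ (N : ℕ+) (g : Aut (R N).AN.base),
    pull tf.divisorMonoid g.hom (ModelFrobenioid.div (R N).pair.num) = ModelFrobenioid.div (R N).pair.num)
  (hinvp : ∀ (N : ℕ+) (y : 𝒯.PiX), y ∈ 𝒯.PiYdd →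
    pull tf.divisorMonoid ((BiKummerSetting.mkOfConnectedTemperoidYddTower X tf hZ hP NH 𝒯 ιX).galoisSurj (R N).AN.base
      (R N).αData.isGalois (ιX y)).hom (ModelFrobenioid.div (R N).pair.den) = ModelFrobenioid.div (R N).pair.den)
  (α : ∀ {N N' : ℕ+}, (N : ℕ) ∣ N' → ((R N').AN ⟶ (R N).AN))
  (β : ∀ {N N' : ℕ+}, (N : ℕ) ∣ N' → ((R N').BN ⟶ (R N).BN))
  (comm_sCap : ∀ {N N' : ℕ+} (hd : (N : ℕ) ∣ N'), (R N').pair.num ≫ β hd = α hd ≫ (R N).pair.num)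
  (comm_sCup : ∀ {N N' : ℕ+} (hd : (N : ℕ) ∣ N'), (R N').pair.den ≫ β hd = α hd ≫ (R N).pair.den)
  (isIsometry_α : ∀ {N N' : ℕ+} (hd : (N : ℕ) ∣ N'),
    ((BiKummerSetting.mkOfConnectedTemperoidYddTower X tf hZ hP NH 𝒯 ιX).sec5Stub h).pre.IsIsometry (α hd))
  (degFr_α : ∀ {N N' : ℕ+} (hd : (N : ℕ) ∣ N'),
    (((BiKummerSetting.mkOfConnectedTemperoidYddTower X tf hZ hP NH 𝒯 ιX).sec5Stub h).pre.degFr (α hd) : ℕ) * N = N')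
  (isIsometry_β : ∀ {N N' : ℕ+} (hd : (N : ℕ) ∣ N'),
    ((BiKummerSetting.mkOfConnectedTemperoidYddTower X tf hZ hP NH 𝒯 ιX).sec5Stub h).pre.IsIsometry (β hd))
  (degFr_β : ∀ {N N' : ℕ+} (hd : (N : ℕ) ∣ N'),
    (((BiKummerSetting.mkOfConnectedTemperoidYddTower X tf hZ hP NH 𝒯 ιX).sec5Stub h).pre.degFr (β hd) : ℕ) * N = N')
  (baseFrob_α : ∀ {N N' : ℕ+} (hd : (N : ℕ) ∣ N'),
    (BiKummerSetting.mkOfConnectedTemperoidYddTower X tf hZ hP NH 𝒯 ιX).IsOfBaseFrobeniusType (α hd))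
  (h44 : BiKummerSetting.Thm44Hyp (BiKummerSetting.mkOfConnectedTemperoidYddTower X tf hZ hP NH 𝒯 ιX)
    (BiKummerSetting.mkOfConnectedTemperoidYddTower X tf hZ hP NH 𝒯 ιX))
  (ψ : ∀ A : (BiKummerSetting.mkOfConnectedTemperoidYddTower X tf hZ hP NH 𝒯 ιX).C,
    (BiKummerSetting.mkOfConnectedTemperoidYddTower X tf hZ hP NH 𝒯 ιX).biratUnits A ≃*
      (BiKummerSetting.mkOfConnectedTemperoidYddTower X tf hZ hP NH 𝒯 ιX).biratUnits (h44.Ψ.functor.obj A))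
  (hpull : ∀ {A A' : (BiKummerSetting.mkOfConnectedTemperoidYddTower X tf hZ hP NH 𝒯 ιX).C} (φ : A' ⟶ A)
    (f : (BiKummerSetting.mkOfConnectedTemperoidYddTower X tf hZ hP NH 𝒯 ιX).biratUnits A),
      ψ A' (pullFrac φ f) = pullFrac (h44.Ψ.functor.map φ) (ψ A f))
  (hii : BiKummerSetting.Thm44_ii h44 ψ) (h3 : h44.PreservesFrobeniusStructure) (h4b : h44.PreservesBaseFrobeniusTypeData)
  (h8 : h44.PreservesAmple) (h15a : h44.PreservesFixedByHA ψ) (h15 : h44.PreservesSaturated ψ)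
  -- (B1)/(B1′): the Def. 4.1 (iv) datum of each transition `α_{1,N}` and its pull-back compatibility
  (D : ∀ N : ℕ+, (BiKummerSetting.mkOfConnectedTemperoidYddTower X tf hZ hP NH 𝒯 ιX).BaseFrobeniusTypeData (α (one_dvd_level N)))

include hX₀ h hc₀ ht comm_sCap comm_sCup isIsometry_α degFr_α isIsometry_β degFr_β hpull hii h3 h4b h8 h15a h15 D in
/-- **[EtTh] Theorem 5.7 at the genuine connected tower — FINAL KNIT v6 (root side), constant field an MLF**: abc-iut-f-123's
`thetaRootPreservedAll_ofConnectedTemperoidYddFamily_final_v6` (p476561) with the (C) clause `hK` («`⋂_N (K'^×)^N = 1`», Prop. 3.2 (iii))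
DISCHARGED by `MLFDivisible.units_eq_one_of_forall_exists_pow_eq p K'` under `[Algebra ℚ_[p] K'] [FiniteDimensional ℚ_[p] K']`; every
other binder VERBATIM p476561 (its module docstring has the census; displayed (C) = `htorsfam`).
[cite: MochizukiEtTh2009, Thm 5.7 p.329–330 (PDF pp.103–104); Prop 3.2 (iii) p.296 (PDF p.70); §5 p.322 (PDF p.96); Lem 5.8 p.331 (PDF p.105)] -/
theorem thetaRootPreservedAll_ofConnectedTemperoidYddFamily_final_v6_of_mlf
    (T : ThetaFrobenioidTower.{0} (BiKummerSetting.mkOfConnectedTemperoidYddTower X tf hZ hP NH 𝒯 ιX).C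
      (ConnectedPart (BTemp X.Pi)))
    (hT : T = ofConnectedTemperoidFamily h Q odd_l R ιX K' (fun N => (Units.map (tf.ratFnFunctor.map (t N).op).hom).comp c₀)
      (fun N => tf.unitsMap_comp_injective (t N) hc₀ (ht N)) hinvc hinvp α β comm_sCap comm_sCup isIsometry_α degFr_α
      isIsometry_β degFr_β baseFrob_α)
    (hnd : IsNonDilatingOn tf.divisorMonoid)
    -- (A) Lemma 5.8's geometric connectedness at EVERY level `N`: «a unit of `B_N` commuting with `s^⊓-gp_N(Im Π^tp_Y̲)` is a constant»
    -- (displayed; its level-1 instance is what v1–v5 discharged from the ONE `ConstantsDictionary` junction binder)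
    (hgc : ∀ (N : ℕ+) (u : (T.atLevel N).units (T.BN N)),
      (∀ y ∈ (T.atLevel N).imPiY, T.sgpCap N y * (u : Aut (T.BN N)) * (T.sgpCap N y)⁻¹ = u) →
        (T.atLevel N).unitsToBirat (T.BN N) u ∈ (T.constEmb N).range)
    -- (A) `hfac₁` RE-KEYED (abc-iut-w5-d123 p447915): Prop. 3.4 (ii), the identification `D → D₀ → D^cnst ≅ aug_* ⋙ G`, and `hYdd`
    {Dcnst : Type u₁} [Category.{v₁} Dcnst] (cnst : D₀ ⥤ Dcnst) (G : ConnectedPart (BTemp (Field.absoluteGaloisGroup K)) ⥤ Dcnst)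
    (ecn : tf.base ⋙ cnst ≅ QuasiTemperoid.pushforward X.aug.toMonoidHom X.aug_surjective X.augIsOpenMap_holds ⋙ G)
    (hP34 : RealifiedDivisorMonoids.Prop34Cnst T₀ cnst)
    (hYdd : ∀ y : 𝒯.PiX, ∃ k ∈ 𝒯.PiYdd, X.aug (ιX k) = X.aug (ιX y))
    -- the rendering law of `pullFrac` (the model's `((·)^birat)^*`), the transitions over the base pair, and the Prop. 2.4-class
    -- clause at the chosen first root ("`S₂^bs` characteristic", p.329): these DISCHARGE `hpull₂`, `hD`, `hf`, `hΨFT`, `hbs` of `…_final`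
    (hF : ∀ {B B' : (BiKummerSetting.mkOfConnectedTemperoidYddTower X tf hZ hP NH 𝒯 ιX).C} (φ : B' ⟶ B)
      (y : (BiKummerSetting.mkOfConnectedTemperoidYddTower X tf hZ hP NH 𝒯 ιX).biratUnits B), pullFrac φ y = tf.pullFracModel φ y)
    (hαover : ∀ N : ℕ+, α (one_dvd_level N) ≫ (R 1).α = (R N).α)
    -- «`A_N^bs` characteristic» at EVERY level (the [EtTh] Prop. 2.4-class clause; its `N = 1` instance is v2's `hcharN`; it yields v2's `hebs`)
    (hcharAN : ∀ N : ℕ+, IsTopCharacteristic X.Pi (galoisSurjOf X.isTempered (R N).AN.base.obj (R N).αData.isGalois).ker)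
    (hdivA : ∀ αA : h44.Ψ.functor.obj (T.AN 1) ≅ T.AN 1, ∃ ε : Aut (T.AN 1),
      T.pre.div (αA.inv ≫ h44.Ψ.functor.map (T.sCap 1)) = T.pre.div (ε.hom ≫ T.sCap 1) ∧
      T.pre.div (αA.inv ≫ h44.Ψ.functor.map (T.sCup 1)) = T.pre.div (ε.hom ≫ T.sCup 1))
    (hP24 : ∀ γ : 𝒯.PiX ≃ₜ* 𝒯.PiX, 𝒯.PiYdd.map γ.toMulEquiv.toMonoidHom = 𝒯.PiYdd)
    -- [EtTh] LEMMA 5.8 FOR CONSTANTS, print verbatim: «(K^×)^{1/N} ⊆ O^×(B_N^birat)» — every constant `c ∈ K'^×` read on `B_N^bs` (along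
    -- `t N`) has an `N`-th root in `B(B_N^bs)^×` (p.331 (PDF p.105)); it feeds the root clause at the PRODUCED anchor, whose discrepancy
    -- unit is a constant (the fixedness half, Def 3.6 (iii), is then a theorem — abc-iut-f-123 p455663)
    (h58N : ∀ (N : ℕ+) (c : K'ˣ), ∃ r : tf.biratUnitsModel (R N).BN,
      (r : tf.ratFnFunctor.obj (op (R N).BN.base)) ^ (N : ℕ) = (tf.ratFnFunctor.map (t N).op).hom (c₀ c : tf.ratFnFunctor.obj (op X₀)))
    -- [EtTh] Prop 4.2 (iv) L05 input OVER THE DOMAIN `A_1` of the twisted level-1 pair: the roots-of-constants law (abc-iut-w4-d044's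
    -- `hL`, G-w4d044-1's shape at `A := A_1`; [FrdII] Rmk 2.2.1) — consumed ONLY by `Prop42Sub.unitRootsUpstairsAt_of_constantRootsAt`
    (hL : ∀ (A'' : (BiKummerSetting.mkOfConnectedTemperoidYddTower X tf hZ hP NH 𝒯 ιX).C) (N : ℕ+)
      (g : A''.base ⟶ (R 1).AN.base) (ξ : tf.ratFnFunctor.obj (op (R 1).AN.base)),
      (BiKummerSetting.mkOfConnectedTemperoidYddTower X tf hZ hP NH 𝒯 ιX).IsFrobeniusTrivial A'' →
      (BiKummerSetting.mkOfConnectedTemperoidYddTower X tf hZ hP NH 𝒯 ιX).IsNHSaturatedBsFld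
        (BiKummerSetting.mkOfConnectedTemperoidYddTower X tf hZ hP NH 𝒯 ιX).HodotBsFld A'' N →
      divB tf.divisorMonoid tf.ratFnFunctor tf.divBNatTrans (op (R 1).AN.base) ξ = 1 →
        ∃ ζ : tf.ratFnFunctor.obj (op A''.base), ζ ^ (N : ℕ) = pull tf.ratFnFunctor g ξ)
    -- (C) in TORSION shape (abc-iut-w6-d049 p473372): `⋂_N (K^×)^N = 1` (Prop 3.2 (iii)) and, at every level of the tower's cofinal
    -- index set `E` and for every family member `(a, b, w)` coherent with the CONSTANT normalised anchor, the Kummer cocycle of `w^{2l}`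
    -- along `H_{B_N}` is that of a torsion unit (Cor 2.8 (i) on Prop 5.2 (iii)'s classes via Thm 5.6 — the étale half instantiates it)
    -- (C) Prop. 3.2 (iii) `⋂_N (K'^×)^N = 1` is NO LONGER A BINDER: `K'` is a finite extension of `ℚ_p` (print p.322 «K a finite
    -- extension of ℚ_p»), and the clause is abc-iut-f-123's theorem `MLFDivisible.units_eq_one_of_forall_exists_pow_eq` (p480502)
    (p : ℕ) [Fact p.Prime] [Algebra ℚ_[p] K'] [FiniteDimensional ℚ_[p] K']
    (htorsfam : ∀ (α₁ : h44.Ψ.functor.obj (T.AN 1) ≅ T.AN 1) (β₁ : h44.Ψ.functor.obj (T.BN 1) ≅ T.BN 1) (u₁ : Aut (T.BN 1))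
      (hu₁ : u₁ ∈ (T.atLevel 1).units (T.BN 1)),
      α₁.inv ≫ h44.Ψ.functor.map (T.sCap 1) ≫ β₁.hom = T.sCap 1 →
      α₁.inv ≫ h44.Ψ.functor.map (T.sCup 1) ≫ β₁.hom = T.sCup 1 ≫ u₁.hom →
      ∀ c : T.Kˣ, (T.atLevel 1).unitsToBirat (T.BN 1) ⟨u₁, hu₁⟩ = T.constEmb 1 c →
      ∀ N ∈ E, ∀ (a : h44.Ψ.functor.obj (T.AN N) ≅ T.AN N) (b : h44.Ψ.functor.obj (T.BN N) ≅ T.BN N) (w : Aut (T.BN N)),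
        w ∈ (T.atLevel N).units (T.BN N) →
        a.inv ≫ h44.Ψ.functor.map (T.sCap N) ≫ b.hom = T.sCap N →
        a.inv ≫ h44.Ψ.functor.map (T.sCup N) ≫ b.hom = T.sCup N ≫ w.hom →
        a.inv ≫ h44.Ψ.functor.map (T.α (one_dvd_level N)) ≫ α₁.hom = T.α (one_dvd_level N) →
        b.inv ≫ h44.Ψ.functor.map (T.β (one_dvd_level N)) ≫ β₁.hom = T.β (one_dvd_level N) →
          ∃ u ∈ (T.atLevel N).muTorsion (T.BN N) N, ∀ k : (T.atLevel N).PiYdd,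
            T.sgpCup N ((T.atLevel N).rhoYdd k) * w ^ (2 * T.l) * (T.sgpCup N ((T.atLevel N).rhoYdd k))⁻¹ * (w ^ (2 * T.l))⁻¹ =
              T.sgpCup N ((T.atLevel N).rhoYdd k) * u * (T.sgpCup N ((T.atLevel N).rhoYdd k))⁻¹ * u⁻¹) :
    T.ThetaRootPreservedAll h44.Ψ := by
  -- Prop. 3.2 (iii) for the MLF `K'`, read on `T.K` (which IS `K'` along `hT`)
  have hK : ∀ x : T.Kˣ, (∀ N : ℕ+, ∃ d : T.Kˣ, d ^ (N : ℕ) = x) → x = 1 := by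
    rw [hT]
    exact MLFDivisible.units_eq_one_of_forall_exists_pow_eq p K'
  exact thetaRootPreservedAll_ofConnectedTemperoidYddFamily_final_v6 𝒯 ιX h Q odd_l R K' hX₀ t c₀ hc₀ ht hinvc hinvp α β comm_sCap
    comm_sCup isIsometry_α degFr_α isIsometry_β degFr_β baseFrob_α h44 ψ hpull hii h3 h4b h8 h15a h15 D T hT hnd hgc cnst G ecn hP34 hYdd
    hF hαover hcharAN hdivA hP24 h58N hL hK htorsfam

end DictionaryV6MLF

section SettingV6EMLF

variable {p : ℕ} [Fact p.Prime] {DS : ThetaSetting p} {ES : DS.EtaleThetaData} {l' : ℕ} (Cu : ES.DoubleUnderline l')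
  {e' : DS.toTemperedCurve.GroupLevelData} {Es : Set ℕ+} (τ : DS.CyclotomeTower l' Es) (hC : DS.Compat) (hS : DS.Sec2Hyps)
  {D₀ : Type} [Category.{v₀} D₀] {V : FrdIMonoidStub.{0}} {T₀ : RealifiedDivisorMonoids (D₀ := D₀) V}
  {VD : FrdICatStub.{1, 0, 0} (ConnectedPart (BTemp (Cu.temperedArithmeticGroup e').Pi))}
  {tf : TemperedFrobenioid T₀ (ConnectedPart (BTemp (Cu.temperedArithmeticGroup e').Pi)) VD} {hZ : tf.monoidType = MonoidType.Z}
  {hP : ∀ A : (ConnectedPart (BTemp (Cu.temperedArithmeticGroup e').Pi))ᵒᵖ, IsPerfect (tf.Φ.carrier A)}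
  {NH : Subgroup (Field.absoluteGaloisGroup DS.K) → tf.category → ℕ+ → Prop}
  {pullFrac : ∀ {A A' : (BiKummerSetting.mkOfConnectedTemperoidYddTower (Cu.temperedArithmeticGroup e') tf hZ hP NH
      (Cu.thetaEnvTower τ hC hS) (ContinuousMulEquiv.refl _)).C} (_ : A' ⟶ A),
    (BiKummerSetting.mkOfConnectedTemperoidYddTower (Cu.temperedArithmeticGroup e') tf hZ hP NH (Cu.thetaEnvTower τ hC hS)
        (ContinuousMulEquiv.refl _)).biratUnits A →
      (BiKummerSetting.mkOfConnectedTemperoidYddTower (Cu.temperedArithmeticGroup e') tf hZ hP NH (Cu.thetaEnvTower τ hC hS)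
        (ContinuousMulEquiv.refl _)).biratUnits A'}
  {θ : (BiKummerSetting.mkOfConnectedTemperoidYddTower (Cu.temperedArithmeticGroup e') tf hZ hP NH (Cu.thetaEnvTower τ hC hS)
      (ContinuousMulEquiv.refl _)).biratUnits
    (BiKummerSetting.mkOfConnectedTemperoidYddTower (Cu.temperedArithmeticGroup e') tf hZ hP NH (Cu.thetaEnvTower τ hC hS)
      (ContinuousMulEquiv.refl _)).Aodot}
  {Bl : (BiKummerSetting.mkOfConnectedTemperoidYddTower (Cu.temperedArithmeticGroup e') tf hZ hP NH (Cu.thetaEnvTower τ hC hS)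
      (ContinuousMulEquiv.refl _)).C}
  {Pl : (BiKummerSetting.mkOfConnectedTemperoidYddTower (Cu.temperedArithmeticGroup e') tf hZ hP NH (Cu.thetaEnvTower τ hC hS)
      (ContinuousMulEquiv.refl _)).FractionPair θ Bl}
  {Rl : (BiKummerSetting.mkOfConnectedTemperoidYddTower (Cu.temperedArithmeticGroup e') tf hZ hP NH (Cu.thetaEnvTower τ hC hS)
      (ContinuousMulEquiv.refl _)).NthRoot θ Pl Cu.lPNat pullFrac}
  (h : ModelFrobenioid.Hypotheses tf.divisorMonoid tf.ratFnFunctor)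
  (Q : FrobenioidTheta.ThetaSubquotientStub.{0} (ConnectedPart (BTemp (Cu.temperedArithmeticGroup e').Pi)))
  (R : ∀ N : ℕ+, (BiKummerSetting.mkOfConnectedTemperoidYddTower (Cu.temperedArithmeticGroup e') tf hZ hP NH
      (Cu.thetaEnvTower τ hC hS) (ContinuousMulEquiv.refl _)).NthRoot Rl.root Rl.pair N pullFrac)
  (K' : Type) [Field K'] {X₀ : ConnectedPart (BTemp (Cu.temperedArithmeticGroup e').Pi)}
  (hX₀ : ∀ Y : ConnectedPart (BTemp (Cu.temperedArithmeticGroup e').Pi), Subsingleton (Y ⟶ X₀))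
  (t : ∀ N : ℕ+, (R N).BN.base ⟶ X₀) (c₀ : K'ˣ →* (tf.ratFnFunctor.obj (op X₀))ˣ)
  (hc₀ : Function.Injective c₀) (ht : ∀ N : ℕ+, Function.Injective (tf.ratFnFunctor.map (t N).op).hom)
  (hinvc : ∀ (N : ℕ+) (g : Aut (R N).AN.base),
    pull tf.divisorMonoid g.hom (ModelFrobenioid.div (R N).pair.num) = ModelFrobenioid.div (R N).pair.num)
  (hinvp : ∀ (N : ℕ+) (y : (Cu.thetaEnvTower τ hC hS).PiX), y ∈ (Cu.thetaEnvTower τ hC hS).PiYdd →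
    pull tf.divisorMonoid ((BiKummerSetting.mkOfConnectedTemperoidYddTower (Cu.temperedArithmeticGroup e') tf hZ hP NH
      (Cu.thetaEnvTower τ hC hS) (ContinuousMulEquiv.refl _)).galoisSurj (R N).AN.base (R N).αData.isGalois
        ((ContinuousMulEquiv.refl _) y)).hom (ModelFrobenioid.div (R N).pair.den) = ModelFrobenioid.div (R N).pair.den)
  (α : ∀ {N N' : ℕ+}, (N : ℕ) ∣ N' → ((R N').AN ⟶ (R N).AN))
  (β : ∀ {N N' : ℕ+}, (N : ℕ) ∣ N' → ((R N').BN ⟶ (R N).BN))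
  (comm_sCap : ∀ {N N' : ℕ+} (hd : (N : ℕ) ∣ N'), (R N').pair.num ≫ β hd = α hd ≫ (R N).pair.num)
  (comm_sCup : ∀ {N N' : ℕ+} (hd : (N : ℕ) ∣ N'), (R N').pair.den ≫ β hd = α hd ≫ (R N).pair.den)
  (isIsometry_α : ∀ {N N' : ℕ+} (hd : (N : ℕ) ∣ N'),
    ((BiKummerSetting.mkOfConnectedTemperoidYddTower (Cu.temperedArithmeticGroup e') tf hZ hP NH (Cu.thetaEnvTower τ hC hS)
      (ContinuousMulEquiv.refl _)).sec5Stub h).pre.IsIsometry (α hd))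
  (degFr_α : ∀ {N N' : ℕ+} (hd : (N : ℕ) ∣ N'),
    (((BiKummerSetting.mkOfConnectedTemperoidYddTower (Cu.temperedArithmeticGroup e') tf hZ hP NH (Cu.thetaEnvTower τ hC hS)
      (ContinuousMulEquiv.refl _)).sec5Stub h).pre.degFr (α hd) : ℕ) * N = N')
  (isIsometry_β : ∀ {N N' : ℕ+} (hd : (N : ℕ) ∣ N'),
    ((BiKummerSetting.mkOfConnectedTemperoidYddTower (Cu.temperedArithmeticGroup e') tf hZ hP NH (Cu.thetaEnvTower τ hC hS)
      (ContinuousMulEquiv.refl _)).sec5Stub h).pre.IsIsometry (β hd))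
  (degFr_β : ∀ {N N' : ℕ+} (hd : (N : ℕ) ∣ N'),
    (((BiKummerSetting.mkOfConnectedTemperoidYddTower (Cu.temperedArithmeticGroup e') tf hZ hP NH (Cu.thetaEnvTower τ hC hS)
      (ContinuousMulEquiv.refl _)).sec5Stub h).pre.degFr (β hd) : ℕ) * N = N')
  (baseFrob_α : ∀ {N N' : ℕ+} (hd : (N : ℕ) ∣ N'),
    (BiKummerSetting.mkOfConnectedTemperoidYddTower (Cu.temperedArithmeticGroup e') tf hZ hP NH (Cu.thetaEnvTower τ hC hS)
      (ContinuousMulEquiv.refl _)).IsOfBaseFrobeniusType (α hd))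
  -- the §4 package `h44` and its Thm. 4.4 clauses (as in '_final_v3')
  (h44 : BiKummerSetting.Thm44Hyp
    (BiKummerSetting.mkOfConnectedTemperoidYddTower (Cu.temperedArithmeticGroup e') tf hZ hP NH (Cu.thetaEnvTower τ hC hS)
      (ContinuousMulEquiv.refl _))
    (BiKummerSetting.mkOfConnectedTemperoidYddTower (Cu.temperedArithmeticGroup e') tf hZ hP NH (Cu.thetaEnvTower τ hC hS)
      (ContinuousMulEquiv.refl _)))
  (ψ : ∀ A : (BiKummerSetting.mkOfConnectedTemperoidYddTower (Cu.temperedArithmeticGroup e') tf hZ hP NH (Cu.thetaEnvTower τ hC hS)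
      (ContinuousMulEquiv.refl _)).C,
    (BiKummerSetting.mkOfConnectedTemperoidYddTower (Cu.temperedArithmeticGroup e') tf hZ hP NH (Cu.thetaEnvTower τ hC hS)
        (ContinuousMulEquiv.refl _)).biratUnits A ≃*
      (BiKummerSetting.mkOfConnectedTemperoidYddTower (Cu.temperedArithmeticGroup e') tf hZ hP NH (Cu.thetaEnvTower τ hC hS)
        (ContinuousMulEquiv.refl _)).biratUnits (h44.Ψ.functor.obj A))
  (hpull : ∀ {A A' : (BiKummerSetting.mkOfConnectedTemperoidYddTower (Cu.temperedArithmeticGroup e') tf hZ hP NH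
      (Cu.thetaEnvTower τ hC hS) (ContinuousMulEquiv.refl _)).C} (φ : A' ⟶ A)
    (f : (BiKummerSetting.mkOfConnectedTemperoidYddTower (Cu.temperedArithmeticGroup e') tf hZ hP NH (Cu.thetaEnvTower τ hC hS)
      (ContinuousMulEquiv.refl _)).biratUnits A),
      ψ A' (pullFrac φ f) = pullFrac (h44.Ψ.functor.map φ) (ψ A f))
  (hii : BiKummerSetting.Thm44_ii h44 ψ) (h3 : h44.PreservesFrobeniusStructure) (h4b : h44.PreservesBaseFrobeniusTypeData)
  (h8 : h44.PreservesAmple) (h15a : h44.PreservesFixedByHA ψ) (h15 : h44.PreservesSaturated ψ)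
  -- (B1)/(B1′): the Def. 4.1 (iv) datum of each transition `α_{1,N}`
  (D : ∀ N : ℕ+, (BiKummerSetting.mkOfConnectedTemperoidYddTower (Cu.temperedArithmeticGroup e') tf hZ hP NH (Cu.thetaEnvTower τ hC hS)
      (ContinuousMulEquiv.refl _)).BaseFrobeniusTypeData (α (one_dvd_level N)))

include hX₀ h hc₀ ht comm_sCap comm_sCup isIsometry_α degFr_α isIsometry_β degFr_β hpull hii h3 h4b h8 h15a h15 D in
/-- **[EtTh] Theorem 5.7 — FINAL KNIT v6 at the tower OF THE SETTING, (C) supplied by the étale side, constant field an MLF**: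
abc-iut-w6-d049's (e3) `thetaRootPreservedAll_ofThetaSettingYddFamily_final_v6_of_cor219iiiStd` (p480505) with the (C) clause `hK`
(«`⋂_N (K'^×)^N = 1`», Prop. 3.2 (iii)) DISCHARGED by `MLFDivisible.units_eq_one_of_forall_exists_pow_eq p K'` under
`[Algebra ℚ_[p] K'] [FiniteDimensional ℚ_[p] K']`, `p` the residue characteristic of the Setting; every other binder VERBATIM p480505
(its module docstring has the census: dictionary at every `M ∈ Es`, compatible pins `η`, `(γ, γ_μ)` + `hstd` (F-0652 SHAPE), glue, `hinfη`,
`hsep`, `hK4fam`).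
[cite: MochizukiEtTh2009, Thm 5.7 p.329–330 (PDF pp.103–104); Prop 3.2 (iii) p.296 (PDF p.70); §5 p.322 (PDF p.96); Thm 5.6 p.328 (PDF p.102); Cor 2.19 (iii) p.291 (PDF p.65)] -/
theorem thetaRootPreservedAll_ofThetaSettingYddFamily_final_v6_of_cor219iiiStd_of_mlf
    (T : ThetaFrobenioidTower.{0} (BiKummerSetting.mkOfConnectedTemperoidYddTower (Cu.temperedArithmeticGroup e') tf hZ hP NH
      (Cu.thetaEnvTower τ hC hS) (ContinuousMulEquiv.refl _)).C (ConnectedPart (BTemp (Cu.temperedArithmeticGroup e').Pi)))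
    (hT : T = ofThetaSettingFamily τ hC hS h Q R K' (fun N => (Units.map (tf.ratFnFunctor.map (t N).op).hom).comp c₀)
      (fun N => tf.unitsMap_comp_injective (t N) hc₀ (ht N)) hinvc hinvp α β comm_sCap comm_sCup isIsometry_α degFr_α
      isIsometry_β degFr_β baseFrob_α)
    -- (A), residual of record: print's standing hypothesis "`Φ` non-dilating" (Prop. 5.1 / Thm. 4.4)
    (hnd : IsNonDilatingOn tf.divisorMonoid)
    -- (A) Lemma 5.8's geometric connectedness at EVERY level `N`: «a unit of `B_N` commuting with `s^⊓-gp_N(Im Π^tp_Y̲)` is a constant»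
    -- (displayed; its level-1 instance is what v1–v5 discharged from the ONE `ConstantsDictionary` junction binder)
    (hgc : ∀ (N : ℕ+) (u : (T.atLevel N).units (T.BN N)),
      (∀ y ∈ (T.atLevel N).imPiY, T.sgpCap N y * (u : Aut (T.BN N)) * (T.sgpCap N y)⁻¹ = u) →
        (T.atLevel N).unitsToBirat (T.BN N) u ∈ (T.constEmb N).range)
    -- (A) `hfac₁` RE-KEYED (p447915): Prop. 3.4 (ii) and the identification `D → D₀ → D^cnst ≅ aug_* ⋙ G` (`hYdd` is a theorem here)
    {Dcnst : Type u₁} [Category.{v₁} Dcnst] (cnst : D₀ ⥤ Dcnst)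
    (G : ConnectedPart (BTemp (Field.absoluteGaloisGroup DS.K)) ⥤ Dcnst)
    (ecn : tf.base ⋙ cnst ≅ QuasiTemperoid.pushforward (Cu.temperedArithmeticGroup e').aug.toMonoidHom
      (Cu.temperedArithmeticGroup e').aug_surjective (Cu.temperedArithmeticGroup e').augIsOpenMap_holds ⋙ G)
    (hP34 : RealifiedDivisorMonoids.Prop34Cnst T₀ cnst)
    -- the rendering law of `pullFrac`, the transitions over the base pair
    (hF : ∀ {B B' : (BiKummerSetting.mkOfConnectedTemperoidYddTower (Cu.temperedArithmeticGroup e') tf hZ hP NH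
        (Cu.thetaEnvTower τ hC hS) (ContinuousMulEquiv.refl _)).C} (φ : B' ⟶ B)
      (y : (BiKummerSetting.mkOfConnectedTemperoidYddTower (Cu.temperedArithmeticGroup e') tf hZ hP NH (Cu.thetaEnvTower τ hC hS)
        (ContinuousMulEquiv.refl _)).biratUnits B), pullFrac φ y = tf.pullFracModel φ y)
    (hαover : ∀ N : ℕ+, α (one_dvd_level N) ≫ (R 1).α = (R N).α)
    -- «`A_N^bs` characteristic in `Π^tp_X̲̲`» at EVERY level (the [EtTh] Prop. 2.4-class clause of '_final_v3'; abc-iut-w6-d077's residual)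
    (hcharAN : ∀ N : ℕ+, IsTopCharacteristic (Cu.temperedArithmeticGroup e').Pi
      (galoisSurjOf (Cu.temperedArithmeticGroup e').isTempered (R N).AN.base.obj (R N).αData.isGalois).ker)
    (hdivA : ∀ αA : h44.Ψ.functor.obj (T.AN 1) ≅ T.AN 1, ∃ ε : Aut (T.AN 1),
      T.pre.div (αA.inv ≫ h44.Ψ.functor.map (T.sCap 1)) = T.pre.div (ε.hom ≫ T.sCap 1) ∧
      T.pre.div (αA.inv ≫ h44.Ψ.functor.map (T.sCup 1)) = T.pre.div (ε.hom ≫ T.sCup 1))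
    -- (anchor) `hP24` RE-KEYED to the frozen FACT F-0620 ([EtTh] Cor. 2.18 (i)) at abc-iut-L2-t8's `Cu.rigidData μ' hC hS h15iii L`
    {N' : ℕ+} (μ' : DS.CyclotomeMod l' N') (h15iii : DS.Prop15iii ES hC) (L : Cu.CuspLabels)
    (h218i : (Cu.rigidData μ' hC hS h15iii L).Cor218_i)
    -- [EtTh] LEMMA 5.8 FOR CONSTANTS, print verbatim: «(K^×)^{1/N} ⊆ O^×(B_N^birat)» — every constant `c ∈ K'^×` read on `B_N^bs` (along
    -- `t N`) has an `N`-th root in `B(B_N^bs)^×` (p.331 (PDF p.105)); it feeds the root clause at the PRODUCED anchor (abc-iut-f-123, v5)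
    (h58N : ∀ (N : ℕ+) (c : K'ˣ), ∃ r : tf.biratUnitsModel (R N).BN,
      (r : tf.ratFnFunctor.obj (op (R N).BN.base)) ^ (N : ℕ) = (tf.ratFnFunctor.map (t N).op).hom (c₀ c : tf.ratFnFunctor.obj (op X₀)))
    -- [EtTh] Prop 4.2 (iv) L05 input OVER THE DOMAIN `A_1 := (R 1).AN` of the twisted level-1 pair: the roots-of-constants law (abc-iut-w4-d044's
    -- `hL`, GAP G-w4d044-1's shape at `A_1`; [FrdII] Rmk 2.2.1) — in v5 consumed ONLY by `Prop42Sub.unitRootsUpstairsAt_of_constantRootsAt`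
    (hL : ∀ (A'' : (BiKummerSetting.mkOfConnectedTemperoidYddTower (Cu.temperedArithmeticGroup e') tf hZ hP NH (Cu.thetaEnvTower τ hC hS)
        (ContinuousMulEquiv.refl _)).C) (N : ℕ+) (g : A''.base ⟶ (R 1).AN.base) (ξ : tf.ratFnFunctor.obj (op (R 1).AN.base)),
      (BiKummerSetting.mkOfConnectedTemperoidYddTower (Cu.temperedArithmeticGroup e') tf hZ hP NH (Cu.thetaEnvTower τ hC hS)
        (ContinuousMulEquiv.refl _)).IsFrobeniusTrivial A'' →
      (BiKummerSetting.mkOfConnectedTemperoidYddTower (Cu.temperedArithmeticGroup e') tf hZ hP NH (Cu.thetaEnvTower τ hC hS)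
        (ContinuousMulEquiv.refl _)).IsNHSaturatedBsFld
        (BiKummerSetting.mkOfConnectedTemperoidYddTower (Cu.temperedArithmeticGroup e') tf hZ hP NH (Cu.thetaEnvTower τ hC hS)
          (ContinuousMulEquiv.refl _)).HodotBsFld A'' N →
      divB tf.divisorMonoid tf.ratFnFunctor tf.divBNatTrans (op (R 1).AN.base) ξ = 1 →
        ∃ ζ : tf.ratFnFunctor.obj (op A''.base), ζ ^ (N : ℕ) = pull tf.ratFnFunctor g ξ)
    -- (C) SUPPLIED BY THE ÉTALE SIDE (abc-iut-w6-d049 p478416): `⋂_N (K^×)^N = 1` (Prop 3.2 (iii)) stays displayed …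
    -- (C) Prop. 3.2 (iii) `⋂_N (K'^×)^N = 1` is NO LONGER A BINDER: `K'` is a finite extension of `ℚ_p` for the residue
    -- characteristic `p` OF THE SETTING (print p.322), and the clause is `MLFDivisible.units_eq_one_of_forall_exists_pow_eq` (p480502)
    [Algebra ℚ_[p] K'] [FiniteDimensional ℚ_[p] K']
    -- … the §5 ↔ §2 dictionary at every level `M ∈ Es` of the tower of the Setting (pins of a COMPATIBLE family `η`) …
    (ι : T.PiX ≃* (Cu.thetaEnvTower τ hC hS).PiX) (hι : ∀ y : T.PiX, y ∈ T.PiYdd ↔ ι y ∈ (Cu.thetaEnvTower τ hC hS).PiYdd)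
    (m : ∀ M : Es, (T.atLevel M).muTorsion (T.atLevel M).BN (T.atLevel M).N ≃* ((Cu.thetaEnvTower τ hC hS).level M).mu)
    (hχ : ∀ M : Es, (T.atLevel M).CyclotomicCharacterCompat ((Cu.thetaEnvTower τ hC hS).level M) ι (m M))
    (HF : ∀ M : Es, (T.atLevel M).Facts)
    (η : ∀ M : Es, (Cu.thetaEnvTower τ hC hS).PiYdd → (Cu.thetaEnvTower τ hC hS).mu M)
    (hη : ∀ M, η M ∈ (Cu.thetaEnvTower τ hC hS).thetaCocycles M)
    (hηc : ∀ (M M' : Es) (hd : (M : ℕ+) ∣ M'), (Cu.thetaEnvTower τ hC hS).red M M' hd ∘ η M' = η M)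
    (hpin : ∀ M : Es, (T.atLevel M).ThetaSectionCompat (HF M) ((Cu.thetaEnvTower τ hC hS).level M) ι (m M) hι (η M))
    -- … the étale data on the tower: `(γ, γ_μ)` with F-0652's conclusion SHAPE, glue, translation-freeness, separation across levels …
    (γ : (Cu.thetaEnvTower τ hC hS).PiX ≃ₜ* (Cu.thetaEnvTower τ hC hS).PiX)
    (hγ : (Cu.thetaEnvTower τ hC hS).PiYdd.map γ.toMulEquiv.toMonoidHom = (Cu.thetaEnvTower τ hC hS).PiYdd)
    (hγ' : ∀ x : (Cu.thetaEnvTower τ hC hS).PiX, x ∈ (Cu.thetaEnvTower τ hC hS).PiYdd → γ x ∈ (Cu.thetaEnvTower τ hC hS).PiYdd)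
    (γμ : ∀ M : Es, (Cu.thetaEnvTower τ hC hS).mu M ≃* (Cu.thetaEnvTower τ hC hS).mu M)
    (hstd : ∃ cf : ∀ M : Es, (Cu.thetaEnvTower τ hC hS).G → (Cu.thetaEnvTower τ hC hS).mu M,
      (∀ M, CycEnvelope.IsEnvCocycle (MonoidHom.id _) ((Cu.thetaEnvTower τ hC hS).chi M) (cf M)) ∧
      (∀ M, IsLocallyConstant (cf M ∘ (Cu.thetaEnvTower τ hC hS).aug)) ∧
      (∀ (M M' : Es) (hd : (M : ℕ+) ∣ M'), (Cu.thetaEnvTower τ hC hS).red M M' hd ∘ cf M' = cf M) ∧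
      (∀ M, (Cu.thetaEnvTower τ hC hS).pullbackCocycle M γ hγ (γμ M) '' (Cu.thetaEnvTower τ hC hS).thetaCocycles M =
        (fun η => η * (cf M ∘ (Cu.thetaEnvTower τ hC hS).aug ∘ (Cu.thetaEnvTower τ hC hS).PiYdd.subtype)) ''
          (Cu.thetaEnvTower τ hC hS).thetaCocycles M) ∧
      ∀ M : Es, ∃ d : (Cu.thetaEnvTower τ hC hS).mu M, ∀ g : (Cu.thetaEnvTower τ hC hS).G,
        cf M g ^ T.l = CycEnvelope.coboundary (MonoidHom.id _) ((Cu.thetaEnvTower τ hC hS).chi M) d g)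
    (hγμχ : ∀ (M : Es) (x : (Cu.thetaEnvTower τ hC hS).PiX) (tt : (Cu.thetaEnvTower τ hC hS).mu M),
      γμ M ((Cu.thetaEnvTower τ hC hS).chi M ((Cu.thetaEnvTower τ hC hS).aug x) tt) =
        (Cu.thetaEnvTower τ hC hS).chi M ((Cu.thetaEnvTower τ hC hS).aug (γ x)) (γμ M tt))
    (hγμred : ∀ (M M' : Es) (hd : (M : ℕ+) ∣ M') (tt : (Cu.thetaEnvTower τ hC hS).mu M'),
      (Cu.thetaEnvTower τ hC hS).red M M' hd (γμ M' tt) = γμ M ((Cu.thetaEnvTower τ hC hS).red M M' hd tt))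
    (haug : ∀ x y : (Cu.thetaEnvTower τ hC hS).PiX, (Cu.thetaEnvTower τ hC hS).aug x = (Cu.thetaEnvTower τ hC hS).aug y →
      (Cu.thetaEnvTower τ hC hS).aug (γ x) = (Cu.thetaEnvTower τ hC hS).aug (γ y))
    (hinfη : ∀ (M : Es) (k k' : (Cu.thetaEnvTower τ hC hS).PiYdd), (Cu.thetaEnvTower τ hC hS).aug k = (Cu.thetaEnvTower τ hC hS).aug k' →
      (η M k)⁻¹ * γμ M (η M ⟨γ.symm k, (Cu.thetaEnvTower τ hC hS).symm_apply_mem_PiYdd_of_map_eq γ hγ k k.2⟩) =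
        (η M k')⁻¹ * γμ M (η M ⟨γ.symm k', (Cu.thetaEnvTower τ hC hS).symm_apply_mem_PiYdd_of_map_eq γ hγ k' k'.2⟩))
    (hsep : ∀ η' : ∀ M : Es, (Cu.thetaEnvTower τ hC hS).PiYdd → (Cu.thetaEnvTower τ hC hS).mu M,
      (∀ M, η' M ∈ (Cu.thetaEnvTower τ hC hS).thetaCocycles M) →
      (∀ (M M' : Es) (hd : (M : ℕ+) ∣ M'), (Cu.thetaEnvTower τ hC hS).red M M' hd ∘ η' M' = η' M) →
      (∀ (M : Es) (k k' : (Cu.thetaEnvTower τ hC hS).PiYdd), (Cu.thetaEnvTower τ hC hS).aug k = (Cu.thetaEnvTower τ hC hS).aug k' →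
        η' M k * (η M k)⁻¹ = η' M k' * (η M k')⁻¹) →
      ∀ M : Es, ∃ d : (Cu.thetaEnvTower τ hC hS).mu M, ∀ k : (Cu.thetaEnvTower τ hC hS).PiYdd,
        (η' M k * (η M k)⁻¹) ^ 2 =
          CycEnvelope.coboundary ((Cu.thetaEnvTower τ hC hS).aug.comp (Cu.thetaEnvTower τ hC hS).PiYdd.subtype)
            ((Cu.thetaEnvTower τ hC hS).chi M) d k)
    -- … and Thm. 5.6 at each family member (base shadow `θ` with its laws, (K4m) at `γ_μ`), quantified EXACTLY like `htorsfam` was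
    (hK4fam : ∀ (α₁ : h44.Ψ.functor.obj (T.AN 1) ≅ T.AN 1) (β₁ : h44.Ψ.functor.obj (T.BN 1) ≅ T.BN 1) (u₁ : Aut (T.BN 1))
      (hu₁ : u₁ ∈ (T.atLevel 1).units (T.BN 1)),
      α₁.inv ≫ h44.Ψ.functor.map (T.sCap 1) ≫ β₁.hom = T.sCap 1 →
      α₁.inv ≫ h44.Ψ.functor.map (T.sCup 1) ≫ β₁.hom = T.sCup 1 ≫ u₁.hom →
      ∀ c : T.Kˣ, (T.atLevel 1).unitsToBirat (T.BN 1) ⟨u₁, hu₁⟩ = T.constEmb 1 c →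
      ∀ N (hN : N ∈ Es), ∀ (a : h44.Ψ.functor.obj (T.AN N) ≅ T.AN N) (b : h44.Ψ.functor.obj (T.BN N) ≅ T.BN N) (w : Aut (T.BN N)),
        w ∈ (T.atLevel N).units (T.BN N) →
        a.inv ≫ h44.Ψ.functor.map (T.sCap N) ≫ b.hom = T.sCap N →
        a.inv ≫ h44.Ψ.functor.map (T.sCup N) ≫ b.hom = T.sCup N ≫ w.hom →
        a.inv ≫ h44.Ψ.functor.map (T.α (one_dvd_level N)) ≫ α₁.hom = T.α (one_dvd_level N) →
        b.inv ≫ h44.Ψ.functor.map (T.β (one_dvd_level N)) ≫ β₁.hom = T.β (one_dvd_level N) →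
          ∃ θb : Aut (T.pre.base.obj (T.BN N)) ≃* Aut (T.pre.base.obj (T.BN N)),
            (T.atLevel N).HB.map θb.toMonoidHom = (T.atLevel N).HB ∧
            (T.atLevel N).StrvTransport h44.Ψ a (Iso.refl _) θb ∧
            (∀ k : T.PiYdd, θb (T.ρ N k) = T.ρ N (ι.symm (γ (ι k)))) ∧
            ∀ x : (Cu.thetaEnvTower τ hC hS).mu ⟨N, hN⟩, (T.atLevel N).psiAut h44.Ψ b
                (((m ⟨N, hN⟩).symm x : (T.atLevel N).muTorsion (T.atLevel N).BN (T.atLevel N).N) : Aut (T.atLevel N).BN) =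
              (((m ⟨N, hN⟩).symm (γμ ⟨N, hN⟩ x) : (T.atLevel N).muTorsion (T.atLevel N).BN (T.atLevel N).N) :
                Aut (T.atLevel N).BN)) :
    T.ThetaRootPreservedAll h44.Ψ := by
  -- Prop. 3.2 (iii) for the MLF `K'`, read on `T.K` (which IS `K'` along `hT`)
  have hK : ∀ x : T.Kˣ, (∀ N : ℕ+, ∃ d : T.Kˣ, d ^ (N : ℕ) = x) → x = 1 := by
    rw [hT]
    exact MLFDivisible.units_eq_one_of_forall_exists_pow_eq p K'
  exact thetaRootPreservedAll_ofThetaSettingYddFamily_final_v6_of_cor219iiiStd Cu τ hC hS h Q R K' hX₀ t c₀ hc₀ ht hinvc hinvp α β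
    comm_sCap comm_sCup isIsometry_α degFr_α isIsometry_β degFr_β baseFrob_α h44 ψ hpull hii h3 h4b h8 h15a h15 D T hT hnd hgc cnst G
    ecn hP34 hF hαover hcharAN hdivA μ' h15iii L h218i h58N hL hK ι hι m hχ HF η hη hηc hpin γ hγ hγ' γμ hstd hγμχ hγμred haug hinfη
    hsep hK4fam

end SettingV6EMLF

end ThetaFrobenioidTower

end Literature.AnabelianGeometry.EtaleTheta

end
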